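import Summits.PneNP.PneNP.Theses.SzkEntropy
import Summits.PneNP.PneNP.Theorems.SzkEntropyPeaThreeNotInP
import Summits.PneNP.PneNP.Theorems.SzkEntropyPeaDegreeReduction
import Literature.Computability.Complexity.PolynomialEntropyApproximation
import Literature.Computability.Complexity.PromiseProofs
import Literature.Computability.Complexity.LengthCompare
import Literature.Computability.Complexity.BranchingFn

/-!
# PneNP / SzkEntropy — the target `PeaThreeNotInP` (stmt-PneNP-10776) along the degree dial

Route `PneNP/SzkEntropy`, target item stmt-PneNP-10776 (`PeaThreeNotInP`, thesis X):
`PEA_3 ∉ PromiseP` — entropy approximation (gap one bit) for sparse CUBIC maps over `F₂` is not in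
promise-`P`.  X is an OPEN hardness statement (⟺ `SZKP_L ⊄ prP` by the completeness theorem of
Dvir–Gutfreund–Rothblum–Vadhan, Thm 1.1 / 4.7); this file does not settle it.  It records, as
SUPPORT lemmas of the item, where X sits in the degree family `PEA_d` (the route's "degree dial":
`d = 1` matrix rank, `d = 2` crux `PeaTwoMemBPP`, `d = 3` = X, `d ≥ 4` no harder by the support
`PeaDegreeReduction`):

* `PEA_mem_PromiseP_of_peaDegreeReduction` — given `PeaDegreeReduction` (`PEA_d ≤ₚ PEA_3` for all
  `d`, known in print: AIK randomizing polynomials), easiness of `PEA_3` propagates to EVERY degree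
  (closure of `PromiseP` under promise reductions, tree theorem
  `PromiseProblem.mem_PromiseP_of_polyTimeReducible_holds`); hence
* `szkEntropy_peaThreeNotInP_iff_exists_of_peaDegreeReduction` /
  `szkEntropy_peaThreeNotInP_iff_of_peaDegreeReduction` — under the degree reduction X is
  equivalent to `∃ d, PEA_d ∉ PromiseP` and to `PEA_d ∉ PromiseP` for each single `d ≥ 3`: X is THE
  hardness statement of the whole family, not a statement about degree `3` in particular;
* `PEA_zero_mem_PromiseP` — the bottom of the dial is easy, UNCONDITIONALLY and inside the tree's
  machine model: a sparse map all of whose monomials are empty is constant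
  (`eval_eq_of_degLE_zero`), so `H(p(U_n)) = 0` (`entropy_eq_zero_of_degLE_zero`), `PEA_0` has no
  yes-instances (`PEA_zero_yes_eq_empty`) and the empty language (in `P`, `empty_mem_P`) separates
  it.  So `PromiseP` does meet the family (X is not true "by vacuity of the model"), and any degree
  witnessing hardness is `≥ 1` (`one_le_of_PEA_not_mem_PromiseP`).

References: Z. Dvir, D. Gutfreund, G. N. Rothblum, S. Vadhan, *On approximating the entropy of
polynomial mappings*, ICS 2011 (ECCC TR10-160), §1 p. 1 (the degree-1 case is linear algebra),
§3 p. 6 (`PEA`), Thm 4.5–4.6 (degree reduction), Thm 1.1 / 4.7; O. Goldreich, *On promise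
problems* (2006), Def. 1.2, Def. 1.4 and §1.2 p. 259 (reductions preserve promise-`P`).
-/

namespace Summit.PneNP.PneNP.Theorems

open Literature.Computability.Complexity _root_.Computability

/-! ### X versus the degree reduction `PeaDegreeReduction` -/

/-- **Under the degree reduction, easiness of `PEA_3` propagates to every degree**: if
`PEA_d ≤ₚ PEA_3` for all `d` (item `PeaDegreeReduction`) and `PEA_3 ∈ PromiseP`, then
`PEA_d ∈ PromiseP` for all `d` (`PromiseP` is closed under promise reductions).
[DvirGutfreundRothblumVadhan2010, Thm 4.5–4.6; Goldreich2006, Def. 1.4 and §1.2 p. 259] -/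
theorem PEA_mem_PromiseP_of_peaDegreeReduction
    (hR : Summit.PneNP.PneNP.Theses.SzkEntropy.PeaDegreeReduction) (h3 : PEA 3 ∈ PromiseP)
    (d : ℕ) : PEA d ∈ PromiseP :=
  PromiseProblem.mem_PromiseP_of_polyTimeReducible_holds (szkEntropy_peaDegreeReduction_iff.1 hR d) h3

/-- **Under the degree reduction, X is the hardness of the whole family**: `PeaThreeNotInP` holds
iff entropy approximation is outside promise-`P` in SOME degree `d`.
[DvirGutfreundRothblumVadhan2010, §1 p. 1 and Thm 4.5–4.6] -/
theorem szkEntropy_peaThreeNotInP_iff_exists_of_peaDegreeReduction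
    (hR : Summit.PneNP.PneNP.Theses.SzkEntropy.PeaDegreeReduction) :
    Summit.PneNP.PneNP.Theses.SzkEntropy.PeaThreeNotInP ↔ ∃ d : ℕ, PEA d ∉ PromiseP := by
  rw [szkEntropy_peaThreeNotInP_iff]
  exact ⟨fun h => ⟨3, h⟩, fun ⟨d, hd⟩ h3 => hd (PEA_mem_PromiseP_of_peaDegreeReduction hR h3 d)⟩

/-- **Under the degree reduction, every `d ≥ 3` gives the same statement**:
`PeaThreeNotInP ↔ PEA_d ∉ PromiseP` for each `d ≥ 3` (upward by monotonicity of the instance sets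
in `d`, `PEA_not_mem_promiseLift_mono`; downward by `PEA_d ≤ₚ PEA_3`).
[DvirGutfreundRothblumVadhan2010, §3 p. 6 and Thm 4.5–4.6] -/
theorem szkEntropy_peaThreeNotInP_iff_of_peaDegreeReduction
    (hR : Summit.PneNP.PneNP.Theses.SzkEntropy.PeaDegreeReduction) {d : ℕ} (hd : 3 ≤ d) :
    Summit.PneNP.PneNP.Theses.SzkEntropy.PeaThreeNotInP ↔ PEA d ∉ PromiseP :=
  ⟨fun h => PEA_not_mem_promiseLift_mono hd (szkEntropy_peaThreeNotInP_iff.1 h),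
    fun h => szkEntropy_peaThreeNotInP_iff.2 fun h3 =>
      h (PEA_mem_PromiseP_of_peaDegreeReduction hR h3 d)⟩

/-! ### The bottom of the degree dial: `PEA_0 ∈ PromiseP` -/

/-- A sparse map all of whose monomials are empty (`DegLE 0`) is constant: every monomial
evaluates to the empty product `1`, so no output depends on the input point.
[DvirGutfreundRothblumVadhan2010, §2 (polynomial maps; degree 0 = constants)] -/
theorem eval_eq_of_degLE_zero {n : ℕ} {P : PolyMapF2 n} (h : P.DegLE 0) (x y : Fin n → ZMod 2) :
    P.eval x = P.eval y := by
  unfold PolyMapF2.eval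
  refine List.map_congr_left fun p hp => ?_
  congr 1
  refine List.map_congr_left fun μ hμ => ?_
  obtain rfl : μ = [] := List.eq_nil_of_length_eq_zero (Nat.le_zero.1 (h p hp μ hμ))
  rfl

/-- A degree-`0` sparse map has output entropy `0` (it is constant, and a constant map has one
fibre of full size, `mapEntropy_const`). [DvirGutfreundRothblumVadhan2010, Claim 2.2] -/
theorem entropy_eq_zero_of_degLE_zero {n : ℕ} {P : PolyMapF2 n} (h : P.DegLE 0) :
    P.entropy = 0 := by
  have hc : P.eval = fun _ => P.eval 0 := funext fun x => eval_eq_of_degLE_zero h x 0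
  unfold PolyMapF2.entropy
  rw [hc]
  exact mapEntropy_const _ _

/-- `PEA_0` has no yes-instances: a yes-instance `(n, p, k)` of degree `0` would need
`k + 1 ≤ H(p(U_n)) = 0` with `k : ℕ`. [DvirGutfreundRothblumVadhan2010, §3 p. 6] -/
theorem PEA_zero_yes_eq_empty : (PEA 0).yes = (∅ : Set (List Bool)) := by
  refine Set.eq_empty_iff_forall_notMem.2 fun w hw => ?_
  obtain ⟨I, hI, -⟩ := hw
  obtain ⟨hdeg, hk⟩ := hI
  rw [entropy_eq_zero_of_degLE_zero hdeg] at hk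
  have h0 : (0 : ℝ) ≤ (I.2.2 : ℝ) := Nat.cast_nonneg _
  linarith

/-- The empty language is in `P` (the constant-`0` decider: `const_mem_FP`, `mem_P_of_mem_FP`).
[AroraBarakCC2009, §1.3] -/
theorem empty_mem_P : ((∅ : Set (List Bool)) : Language Bool) ∈ Classes.P :=
  mem_P_of_mem_FP (const_mem_FP [false]) _ fun _ => ⟨fun h => h.elim, fun _ => rfl⟩

/-- **`PEA_0 ∈ PromiseP`**: entropy approximation of degree-`0` (constant) maps is in promise-`P`
inside the tree's TM2 model — there are no yes-instances, so the empty language separates.  The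
degree dial of the route therefore starts strictly above `0`.
[DvirGutfreundRothblumVadhan2010, §1 p. 1 and §3 p. 6; Goldreich2006, Def. 1.2] -/
theorem PEA_zero_mem_PromiseP : PEA 0 ∈ PromiseP :=
  ⟨(∅ : Set (List Bool)), empty_mem_P, by rw [PEA_zero_yes_eq_empty], fun _ _ h => h⟩

/-- Consequently any degree `d` with `PEA_d ∉ PromiseP` — in particular any witness of X in the
form `szkEntropy_peaThreeNotInP_iff_exists_of_peaDegreeReduction` — is at least `1`.
[DvirGutfreundRothblumVadhan2010, §1 p. 1] -/
theorem one_le_of_PEA_not_mem_PromiseP {d : ℕ} (h : PEA d ∉ PromiseP) : 1 ≤ d := by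
  rcases Nat.eq_zero_or_pos d with rfl | hd
  · exact absurd PEA_zero_mem_PromiseP h
  · exact hd

/-- **X does not come from the bottom of the dial**: under the degree reduction, X holds iff
`PEA_d ∉ PromiseP` for some `d ≥ 1` (combine the two halves above).
[DvirGutfreundRothblumVadhan2010, §1 p. 1 and Thm 4.5–4.6] -/
theorem szkEntropy_peaThreeNotInP_iff_exists_pos_of_peaDegreeReduction
    (hR : Summit.PneNP.PneNP.Theses.SzkEntropy.PeaDegreeReduction) :
    Summit.PneNP.PneNP.Theses.SzkEntropy.PeaThreeNotInP ↔ ∃ d : ℕ, 1 ≤ d ∧ PEA d ∉ PromiseP := by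
  rw [szkEntropy_peaThreeNotInP_iff_exists_of_peaDegreeReduction hR]
  exact ⟨fun ⟨d, hd⟩ => ⟨d, one_le_of_PEA_not_mem_PromiseP hd, hd⟩, fun ⟨d, _, hd⟩ => ⟨d, hd⟩⟩

end Summit.PneNP.PneNP.Theorems
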